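import Mathlib
import Literature.Probability.RandomPlanarGeometry.CurveClassStopAtMeasurable
import Literature.Probability.RandomPlanarGeometry.StopAtThickening
import HarnessLib

/-!
# Generic thickening levels are left-continuity levels of the stopped pasts

Crux `AxiomsOfLimit` (stmt-CriticalPhenomena-1370), line `registered`, stub `stub_markovOfLimit`:
generic-level no-grazing (R2), piece (iii) (lead c4). Theorems only.

For a curve class `c`, a set `F ⊆ ℂ` and a level `s : ℝ` write `F_s := cthickening s F` and
consider the LEVEL PASTS `s ↦ c.stopAt F_s`. This file proves that for every finite Borel
measure `μ` on planar curve classes, Lebesgue-a.e. level `r` is a left-continuity level of the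
level pasts for `μ`-a.e. class (`stub_aeLevelLeftContinuous`):

* `tendsto_hitParam_cthickening_nhdsGE` — for EVERY curve the level hitting parameter
  `s ↦ hitParam F_s γ` is antitone and right-continuous (the hitting points `γ (T s') ∈ F_{s'}`
  accumulate, as `s' ↓ s`, at a point of `⋂ F_{s'} = F_s`);
* `tendsto_stopAt_cthickening_nhdsGE`, `countable_not_continuousAt_stopAt_cthickening` — hence
  the level pasts of every class are right-continuous, and continuous off the countable set of
  discontinuities of an antitone real function (`Antitone.countable_not_continuousAt`);
* `measurable_stopAt_cthickening_uncurry` — `(c, s) ↦ c.stopAt F_s` is jointly Borel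
  (right-continuity in `s`, Borel in `c` at fixed level by the tree's
  `CurveClass.measurable_stopAt`, pointwise limits of measurable maps);
* `measurableSet_tendsto_stopAt_cthickening_nhdsLT` — the set of pairs `(c, r)` at which the
  level pasts are left-continuous is Borel (rational characterisation through right-continuity);
* `stub_aeLevelLeftContinuous` — Fubini (`Measure.ae_ae_comm`): "for every `c`, for a.e. `r`"
  becomes "for a.e. `r`, for `μ`-a.e. `c`".

Folklore: Fubini and the countability of the discontinuities of monotone functions.
References: G. F. Lawler, O. Schramm, W. Werner, Acta Math. 187 (2001), §2 (stopping at closed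
sets); M. Aizenman, A. Burchard, Duke Math. J. 99 (1999), §2.1 (the curve space). All [folklore].
-/

noncomputable section

open MeasureTheory Filter Topology Set Metric
open scoped ENNReal unitInterval

namespace Summit.CriticalPhenomena.SAWScalingLimit.Theorems.AxiomsOfLimitMarkov

open Literature.Probability.RandomPlanarGeometry

/-! ### Level hitting parameters: antitone and right-continuous (every curve) -/

section Metric

variable {E : Type*} [MetricSpace E]

/-- The level hitting parameter `s ↦ hitParam (cthickening s F) γ` is antitone (a larger
thickening is hit earlier). [folklore] -/
theorem antitone_hitParam_cthickening (F : Set E) (γ : Curve E) :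
    Antitone fun s : ℝ => γ.hitParam (cthickening s F) :=
  fun _ _ hst => Curve.hitParam_mono (cthickening_mono hst F) γ

/-- **Sequential right-continuity of the level hitting parameter**:
`hitParam (cthickening (s + 1/(n+1)) F) γ → hitParam (cthickening s F) γ`. The hitting parameters
increase to a limit `L ≤ T`; the hitting points lie in the closed thickenings and accumulate at
`γ L`, whose distance to `F` is therefore at most every `s + 1/(m+1)`, i.e. `γ L ∈ cthickening s F`,
forcing `T ≤ L`. [folklore] -/
theorem tendsto_hitParam_cthickening_add_one_div (F : Set E) (γ : Curve E) (s : ℝ) :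
    Tendsto (fun n : ℕ => γ.hitParam (cthickening (s + 1 / ((n : ℝ) + 1)) F)) atTop
      (𝓝 (γ.hitParam (cthickening s F))) := by
  set t : ℕ → ℝ := fun n => γ.hitParam (cthickening (s + 1 / ((n : ℝ) + 1)) F) with ht
  set T : ℝ := γ.hitParam (cthickening s F) with hT
  have hsub : ∀ n : ℕ, cthickening s F ⊆ cthickening (s + 1 / ((n : ℝ) + 1)) F := fun n =>
    cthickening_mono (le_add_of_nonneg_right (by positivity)) F
  have htT : ∀ n : ℕ, t n ≤ T := fun n => Curve.hitParam_mono (hsub n) γ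
  have hmono : Monotone t := by
    refine monotone_nat_of_le_succ fun n => Curve.hitParam_mono (cthickening_mono ?_ F) γ
    push_cast
    have h := one_div_le_one_div_of_le (a := (n : ℝ) + 1) (b := (n : ℝ) + 1 + 1) (by positivity)
      (by linarith)
    linarith
  have hbdd : BddAbove (range t) := ⟨T, by rintro _ ⟨n, rfl⟩; exact htT n⟩
  have hconv : Tendsto t atTop (𝓝 (⨆ n, t n)) := tendsto_atTop_ciSup hmono hbdd
  set L : ℝ := ⨆ n, t n with hL
  have hLT : L ≤ T := ciSup_le htT
  suffices hTL : T ≤ L by rw [le_antisymm hLT hTL] at hconv; exact hconv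
  by_cases hmeet : ∀ n : ℕ, ∃ u, γ u ∈ cthickening (s + 1 / ((n : ℝ) + 1)) F
  · have hLmem : L ∈ Icc (0 : ℝ) 1 :=
      ⟨(γ.hitParam_mem_Icc _).1.trans (le_ciSup hbdd 0), hLT.trans (γ.hitParam_mem_Icc _).2⟩
    have hpt : ∀ n : ℕ, γ ⟨t n, γ.hitParam_mem_Icc _⟩ ∈ cthickening (s + 1 / ((n : ℝ) + 1)) F :=
      fun n => Curve.apply_hitParam_mem isClosed_cthickening (hmeet n)
    have hlimI : Tendsto (fun n : ℕ => (⟨t n, γ.hitParam_mem_Icc _⟩ : I)) atTop (𝓝 ⟨L, hLmem⟩) := by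
      rw [tendsto_subtype_rng]; exact hconv
    have hγlim : Tendsto (fun n : ℕ => γ ⟨t n, γ.hitParam_mem_Icc _⟩) atTop (𝓝 (γ ⟨L, hLmem⟩)) :=
      (γ.continuous.tendsto _).comp hlimI
    have hmem : γ ⟨L, hLmem⟩ ∈ cthickening s F := by
      -- in every `cthickening (s + 1/(m+1)) F` (closed, containing the tail of the hitting points)
      have hm : ∀ m : ℕ, γ ⟨L, hLmem⟩ ∈ cthickening (s + 1 / ((m : ℝ) + 1)) F := by
        intro m
        refine isClosed_cthickening.mem_of_tendsto hγlim (eventually_atTop.2 ⟨m, fun n hn => ?_⟩)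
        refine cthickening_mono ?_ F (hpt n)
        have hmn : (m : ℝ) ≤ n := by exact_mod_cast hn
        have h := one_div_le_one_div_of_le (a := (m : ℝ) + 1) (b := (n : ℝ) + 1) (by positivity)
          (by linarith)
        linarith
      have hlim : Tendsto (fun m : ℕ => ENNReal.ofReal (s + 1 / ((m : ℝ) + 1))) atTop
          (𝓝 (ENNReal.ofReal s)) := by
        refine ENNReal.tendsto_ofReal ?_
        simpa using tendsto_const_nhds.add (tendsto_one_div_add_atTop_nhds_zero_nat (𝕜 := ℝ))
      rw [mem_cthickening_iff]
      exact ge_of_tendsto' hlim fun m => mem_cthickening_iff.1 (hm m)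
    exact Curve.hitParam_le hmem
  · push Not at hmeet
    obtain ⟨n, hn⟩ := hmeet
    have h1 : t n = 1 := Curve.hitParam_eq_one_of_forall_notMem hn
    exact ((γ.hitParam_mem_Icc _).2.trans_eq h1.symm).trans (le_ciSup hbdd n)

/-- **Right-continuity of the level hitting parameter** at every level, for every curve.
[folklore] -/
theorem tendsto_hitParam_cthickening_nhdsGE (F : Set E) (γ : Curve E) (s : ℝ) :
    Tendsto (fun s' : ℝ => γ.hitParam (cthickening s' F)) (𝓝[≥] s)
      (𝓝 (γ.hitParam (cthickening s F))) := by
  have hanti := antitone_hitParam_cthickening F γ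
  rw [tendsto_order]
  refine ⟨fun a ha => ?_, fun b hb => ?_⟩
  · obtain ⟨n, hn⟩ := ((tendsto_order.1 (tendsto_hitParam_cthickening_add_one_div F γ s)).1 a ha).exists
    have hpos : (0 : ℝ) < 1 / ((n : ℝ) + 1) := by positivity
    filter_upwards [Ico_mem_nhdsGE (show s < s + 1 / ((n : ℝ) + 1) by linarith)] with s' hs'
    exact hn.trans_le (hanti hs'.2.le)
  · filter_upwards [self_mem_nhdsWithin] with s' hs'
    exact (hanti hs').trans_lt hb

/-- The heads `T ↦ mk ⟨γ ∘ affineClamp 0 T⟩` of a fixed curve depend continuously on the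
parameter (uniform continuity of `γ`, `Curve.exists_dist_comp_affineClamp_le`). [folklore] -/
theorem continuous_mk_comp_affineClamp (γ : Curve E) :
    Continuous fun T : ℝ =>
      CurveClass.mk (⟨γ.toContinuousMap.comp (Curve.affineClamp 0 T)⟩ : Curve E) := by
  refine CurveClass.continuous_mk.comp ?_
  rw [Metric.continuous_iff]
  intro T ε hε
  obtain ⟨δ, hδ, h⟩ := Curve.exists_dist_comp_affineClamp_le γ (half_pos hε)
  refine ⟨δ, hδ, fun T' hT' => ?_⟩
  refine (h 0 T' 0 T (by simp [hδ.le]) ?_).trans_lt (half_lt_self hε)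
  rw [Real.dist_eq] at hT'
  exact hT'.le

/-- **Right-continuity of the level pasts** `s ↦ c.stopAt (cthickening s F)` of every curve class
at every level. [folklore] -/
theorem tendsto_stopAt_cthickening_nhdsGE (F : Set E) (c : CurveClass E) (s : ℝ) :
    Tendsto (fun s' : ℝ => c.stopAt (cthickening s' F)) (𝓝[≥] s)
      (𝓝 (c.stopAt (cthickening s F))) :=
  ((continuous_mk_comp_affineClamp c.out).tendsto _).comp
    (tendsto_hitParam_cthickening_nhdsGE F c.out s)

/-- The level pasts are continuous at every continuity level of the level hitting parameter of
the chosen representative. [folklore] -/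
theorem continuousAt_stopAt_cthickening {F : Set E} {c : CurveClass E} {r : ℝ}
    (h : ContinuousAt (fun s : ℝ => c.out.hitParam (cthickening s F)) r) :
    ContinuousAt (fun s : ℝ => c.stopAt (cthickening s F)) r :=
  ((continuous_mk_comp_affineClamp c.out).tendsto _).comp h

/-- **Every class has at most countably many bad levels**: the level pasts are continuous off the
(countable) discontinuity set of an antitone real function. [folklore] -/
theorem countable_not_continuousAt_stopAt_cthickening (F : Set E) (c : CurveClass E) :
    {r : ℝ | ¬ ContinuousAt (fun s : ℝ => c.stopAt (cthickening s F)) r}.Countable :=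
  (antitone_hitParam_cthickening F c.out).countable_not_continuousAt.mono
    fun _ hr hcont => hr (continuousAt_stopAt_cthickening hcont)

/-- For every class, Lebesgue-a.e. level is a left-continuity level of its level pasts.
[folklore] -/
theorem ae_tendsto_stopAt_cthickening_nhdsLT (F : Set E) (c : CurveClass E) :
    ∀ᵐ r ∂(volume : Measure ℝ), Tendsto (fun s : ℝ => c.stopAt (cthickening s F)) (𝓝[<] r)
      (𝓝 (c.stopAt (cthickening r F))) := by
  filter_upwards [(countable_not_continuousAt_stopAt_cthickening F c).ae_notMem volume] with r hr
  have hc : ContinuousAt (fun s : ℝ => c.stopAt (cthickening s F)) r := not_not.1 hr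
  exact hc.tendsto.mono_left nhdsWithin_le_nhds

/-- **Rational characterisation of left-continuity of the level pasts** (through their
right-continuity): left-continuity at `r` iff for every `k` there is an `n` such that all RATIONAL
levels `q ∈ (r - 1/(n+1), r)` give pasts within `1/(k+1)` of the past at `r`. [folklore] -/
theorem tendsto_stopAt_cthickening_nhdsLT_iff (F : Set E) (c : CurveClass E) (r : ℝ) :
    Tendsto (fun s : ℝ => c.stopAt (cthickening s F)) (𝓝[<] r) (𝓝 (c.stopAt (cthickening r F))) ↔
      ∀ k : ℕ, ∃ n : ℕ, ∀ q : ℚ, r - 1 / ((n : ℝ) + 1) < q → (q : ℝ) < r →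
        dist (c.stopAt (cthickening (q : ℝ) F)) (c.stopAt (cthickening r F)) < 1 / ((k : ℝ) + 1) := by
  constructor
  · intro h k
    have hk : (0 : ℝ) < 1 / ((k : ℝ) + 1) := by positivity
    obtain ⟨δ, hδ, hδ'⟩ := Metric.tendsto_nhdsWithin_nhds.1 h _ hk
    obtain ⟨n, hn⟩ := exists_nat_one_div_lt hδ
    refine ⟨n, fun q hq1 hq2 => hδ' hq2 ?_⟩
    rw [Real.dist_eq, abs_sub_comm, abs_of_pos (sub_pos.2 hq2)]
    linarith
  · intro h
    refine Metric.tendsto_nhdsWithin_nhds.2 fun ε hε => ?_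
    obtain ⟨k, hk⟩ := exists_nat_one_div_lt hε
    obtain ⟨n, hn⟩ := h k
    refine ⟨1 / ((n : ℝ) + 1), by positivity, fun s hs hsr => lt_of_le_of_lt ?_ hk⟩
    have hs : s < r := hs
    have hs' : r - 1 / ((n : ℝ) + 1) < s := by
      rw [Real.dist_eq, abs_sub_comm, abs_of_pos (sub_pos.2 hs)] at hsr
      linarith
    -- rational levels `q j ↓ s` inside `(s, r)`
    have hex : ∀ j : ℕ, ∃ q : ℚ, s < q ∧ (q : ℝ) < min r (s + 1 / ((j : ℝ) + 1)) := fun j =>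
      exists_rat_btwn (lt_min hs (by simp only [lt_add_iff_pos_right]; positivity))
    choose q hq1 hq2 using hex
    have hqs : Tendsto (fun j => (q j : ℝ)) atTop (𝓝[≥] s) := by
      refine tendsto_nhdsWithin_iff.2 ⟨?_, Eventually.of_forall fun j => (hq1 j).le⟩
      refine tendsto_of_tendsto_of_tendsto_of_le_of_le tendsto_const_nhds ?_ (fun j => (hq1 j).le)
        (fun j => ((hq2 j).trans_le (min_le_right _ _)).le)
      simpa using tendsto_const_nhds.add (tendsto_one_div_add_atTop_nhds_zero_nat (𝕜 := ℝ))
    have hlim : Tendsto (fun j => dist (c.stopAt (cthickening (q j : ℝ) F)) (c.stopAt (cthickening r F)))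
        atTop (𝓝 (dist (c.stopAt (cthickening s F)) (c.stopAt (cthickening r F)))) :=
      ((tendsto_stopAt_cthickening_nhdsGE F c s).comp hqs).dist tendsto_const_nhds
    exact le_of_tendsto' hlim fun j =>
      (hn (q j) (hs'.trans (hq1 j)) ((hq2 j).trans_le (min_le_left _ _))).le

end Metric

/-! ### Joint measurability and Fubini (planar classes) -/

/-- **`(c, s) ↦ c.stopAt (cthickening s F)` is jointly Borel** on `CurveClass ℂ × ℝ`: it is the
pointwise limit (right-continuity in the level) of the maps `(c, s) ↦ c.stopAt (cthickening (d n s) F)`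
with the right approximations `d n s = ⌈s (n+1)⌉ / (n+1) ↓ s`, each of which factors through the
countable level set `ℤ` and is Borel by the tree's `CurveClass.measurable_stopAt`. [folklore] -/
theorem measurable_stopAt_cthickening_uncurry (F : Set ℂ) :
    Measurable fun p : CurveClass ℂ × ℝ => p.1.stopAt (cthickening p.2 F) := by
  -- right approximations of the level by the lattice `ℤ / (n+1)`: `d n s := ⌈s (n+1)⌉ / (n+1)`
  have hd_ge : ∀ (n : ℕ) (s : ℝ), s ≤ (⌈s * ((n : ℝ) + 1)⌉ : ℝ) / ((n : ℝ) + 1) := fun n s => by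
    have hpos : (0 : ℝ) < (n : ℝ) + 1 := by positivity
    rw [le_div_iff₀ hpos]
    exact Int.le_ceil _
  have hd_lt : ∀ (n : ℕ) (s : ℝ), (⌈s * ((n : ℝ) + 1)⌉ : ℝ) / ((n : ℝ) + 1) < s + 1 / ((n : ℝ) + 1) :=
    fun n s => by
    have hpos : (0 : ℝ) < (n : ℝ) + 1 := by positivity
    rw [div_lt_iff₀ hpos, add_mul, one_div_mul_cancel hpos.ne']
    exact Int.ceil_lt_add_one _
  have hd_tendsto : ∀ s : ℝ,
      Tendsto (fun n : ℕ => (⌈s * ((n : ℝ) + 1)⌉ : ℝ) / ((n : ℝ) + 1)) atTop (𝓝[≥] s) := fun s => by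
    refine tendsto_nhdsWithin_iff.2 ⟨?_, Eventually.of_forall fun n => hd_ge n s⟩
    refine tendsto_of_tendsto_of_tendsto_of_le_of_le tendsto_const_nhds ?_ (fun n => hd_ge n s)
      fun n => (hd_lt n s).le
    simpa using tendsto_const_nhds.add (tendsto_one_div_add_atTop_nhds_zero_nat (𝕜 := ℝ))
  -- each approximating map factors through the countable level set `ℤ`
  have hg : ∀ n : ℕ, Measurable fun p : CurveClass ℂ × ℝ =>
      p.1.stopAt (cthickening ((⌈p.2 * ((n : ℝ) + 1)⌉ : ℝ) / ((n : ℝ) + 1)) F) := by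
    intro n
    have h1 : Measurable fun p : CurveClass ℂ × ℤ =>
        p.1.stopAt (cthickening ((p.2 : ℝ) / ((n : ℝ) + 1)) F) := by
      refine measurable_from_prod_countable_left fun k => ?_
      show Measurable fun c : CurveClass ℂ => c.stopAt (cthickening ((k : ℝ) / ((n : ℝ) + 1)) F)
      exact CurveClass.measurable_stopAt isClosed_cthickening
    have h2 : Measurable fun p : CurveClass ℂ × ℝ => (p.1, ⌈p.2 * ((n : ℝ) + 1)⌉) :=
      measurable_fst.prodMk (measurable_snd.mul_const _).ceil
    have h3 : (fun p : CurveClass ℂ × ℝ =>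
        p.1.stopAt (cthickening ((⌈p.2 * ((n : ℝ) + 1)⌉ : ℝ) / ((n : ℝ) + 1)) F)) =
        (fun p : CurveClass ℂ × ℤ => p.1.stopAt (cthickening ((p.2 : ℝ) / ((n : ℝ) + 1)) F)) ∘
          fun p : CurveClass ℂ × ℝ => (p.1, ⌈p.2 * ((n : ℝ) + 1)⌉) := by
      funext p
      simp only [Function.comp_apply]
    rw [h3]
    exact h1.comp h2
  refine measurable_of_tendsto_metrizable hg (tendsto_pi_nhds.2 fun p => ?_)
  exact (tendsto_stopAt_cthickening_nhdsGE F p.1 p.2).comp (hd_tendsto p.2)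

/-- **The set of pairs `(c, r)` at which the level pasts are left-continuous is Borel** (rational
characterisation `tendsto_stopAt_cthickening_nhdsLT_iff`, joint measurability
`measurable_stopAt_cthickening_uncurry`). [folklore] -/
theorem measurableSet_tendsto_stopAt_cthickening_nhdsLT (F : Set ℂ) :
    MeasurableSet {p : CurveClass ℂ × ℝ | Tendsto (fun s : ℝ => p.1.stopAt (cthickening s F))
      (𝓝[<] p.2) (𝓝 (p.1.stopAt (cthickening p.2 F)))} := by
  have hmeas := measurable_stopAt_cthickening_uncurry F
  have hq : ∀ q : ℚ, Measurable fun p : CurveClass ℂ × ℝ => p.1.stopAt (cthickening (q : ℝ) F) :=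
    fun q => (CurveClass.measurable_stopAt isClosed_cthickening).comp measurable_fst
  have hset : {p : CurveClass ℂ × ℝ | Tendsto (fun s : ℝ => p.1.stopAt (cthickening s F))
      (𝓝[<] p.2) (𝓝 (p.1.stopAt (cthickening p.2 F)))} =
      {p : CurveClass ℂ × ℝ | ∀ k : ℕ, ∃ n : ℕ, ∀ q : ℚ, p.2 - 1 / ((n : ℝ) + 1) < q → (q : ℝ) < p.2 →
        dist (p.1.stopAt (cthickening (q : ℝ) F)) (p.1.stopAt (cthickening p.2 F)) <
          1 / ((k : ℝ) + 1)} := by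
    ext p
    exact tendsto_stopAt_cthickening_nhdsLT_iff F p.1 p.2
  rw [hset]
  refine measurableSet_setOf.2 ?_
  refine Measurable.forall fun k => Measurable.exists fun n => Measurable.forall fun q => ?_
  refine Measurable.imp ?_ (Measurable.imp ?_ ?_)
  · exact (measurable_snd.sub_const _).lt measurable_const
  · exact measurable_const.lt measurable_snd
  · exact ((hq q).dist hmeas).lt measurable_const


/-! ### Registered sub-goal of crux stmt-CriticalPhenomena-1370 (line `registered`, stub `stub_markovOfLimit`) -/

/-- **Registered sub-goal `stub_aeLevelLeftContinuous`** (crux stmt-CriticalPhenomena-1370,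
generic-level no-grazing R2, piece (iii)): for every finite Borel measure `μ` on planar curve
classes and every closed `F`, for Lebesgue-a.e. level `r`, for `μ`-a.e. class `c`, the level pasts
`s ↦ c.stopAt (cthickening s F)` are left-continuous at `r` (every class has countably many bad
levels; the bad set is jointly Borel; Fubini, `Measure.ae_ae_comm`). Closedness of `F` is not
used (thickenings are closed). [folklore] -/
theorem stub_aeLevelLeftContinuous : ∀ (μ : MeasureTheory.Measure (Literature.Probability.RandomPlanarGeometry.CurveClass ℂ)) [MeasureTheory.IsFiniteMeasure μ] (F : Set ℂ), IsClosed F → Filter.Eventually (fun r : ℝ => Filter.Eventually (fun c : Literature.Probability.RandomPlanarGeometry.CurveClass ℂ => Filter.Tendsto (fun s : ℝ => c.stopAt (Metric.cthickening s F)) (nhdsWithin r (Set.Iio r)) (nhds (c.stopAt (Metric.cthickening r F)))) (MeasureTheory.ae μ)) (MeasureTheory.ae (MeasureTheory.volume : MeasureTheory.Measure ℝ)) := by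
  intro μ _ F _
  exact (Measure.ae_ae_comm (μ := μ) (ν := (volume : Measure ℝ))
    (p := fun (c : CurveClass ℂ) (r : ℝ) => Tendsto (fun s : ℝ => c.stopAt (cthickening s F))
      (𝓝[<] r) (𝓝 (c.stopAt (cthickening r F))))
    (measurableSet_tendsto_stopAt_cthickening_nhdsLT F)).1
    (Eventually.of_forall fun c => ae_tendsto_stopAt_cthickening_nhdsLT F c)

end Summit.CriticalPhenomena.SAWScalingLimit.Theorems.AxiomsOfLimitMarkov

end
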